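/-
Copyright: the b2b-balaban cell (near-miss cell 7), T⁴-continuum fan-out, lineage t4-ne7b-p3 (node U5c LARGE-DEVIATION
member P3).  Released under the licence of the surrounding project.
-/
import Summits.QuantumFields.BalabanUV.T4Continuum.Support.SpaceTimeAssemblyLE
import Summits.QuantumFields.BalabanUV.T4Continuum.Support.SpaceTimeRealisedFlow
import Summits.QuantumFields.BalabanUV.T4Continuum.Support.HistoryRealiseTimed

/-!
# Space-time Peierls ∕ Cramér route for NE7b — THE JUNCTION ON THE LE ROAD: on the COUNT carrier reading (iv) is
# DISCHARGED from `Realises ∧ PendingAt ∧ TypeNodup` ALONE (no `RenewAtReach`), and the flow END's binder is inhabited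
# from realised data + readings + typed flow facts

Summits-side support leaf of the T⁴-continuum cell (rung (B)+1 on a FINITE torus only; NOT infinite volume, NOT the
mass gap, NOT the Clay statement; NOT a proof of the spine estimate NE7b).  Lineage `t4-ne7b-p3` (generation 3), node
U5c, skeleton `t4/skeletons/NE7b-t4-ne7b-p3.md` §13.  [folklore] assembly over this lineage's `SpaceTimeRealisedLin`
(`RLin`, `toLinData`, `exists_root_event`, `skelOK_lin`, `latSeparated`, `treeD_eq`, `treeSteps_eq`),
`SpaceTimeRealisedFlow` (levels from the flow), `SpaceTimeAssemblyLE` (`LineageReadingsLE`, `RunReadingsFlowLE`), and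
the COUNT swarm's `HistoryAdmissible` (`PGen`, `TypeNodup`, `distinct_toGen_iff`, `Adm.rootStep_le_lastStep`),
`HistoryRealise` (`Realises`, `PendingAt`, `adm_of_realises`, `renew_lt_reach`, `lt_reach_of_pendingAt`) and
`HistoryRealiseTimed` (**`consistentTLE_toGen_of_realises`**), `HistoryLevelsFlow` (`expOf`, `expOf_succ_le`,
`dropCtl_expOf`) — all BY NAME; nothing printed is asserted; no `[cite:]` tag.

WHAT.
* §1 **`wf_toGen_of_realises`**: a realised history with distinct event types has a WELL-FORMED canonical label for
  the dictionary's window table — `TypeNodup → Realises L s R P Z → P.toGen.WF (dictW R n₁)` — the renewal clause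
  `rootStep ≤ h < reach` from `adm_of_realises` + `renew_lt_reach`, the merger clause from `lt_reach_of_pendingAt`
  (NO `RenewAtReach`: `HistoryAdmissible.PGen.wf_toGen` used it only for `h < reach`, which the geometry gives).
* §2 **`RLin.lineageReadingsLE`**: `LineageReadingsLE D.toLinData.model C K Kc R g A Bad jlo nup …` from the flow side
  conditions, (i) nonnegativity, (ii′) rooting of bad terms before `jlo`, (iii′) `LatSep`, **(iv″) per lineage
  `Realises ∧ PendingAt K ∧ TypeNodup` — NOTHING ELSE** (`ConsistentTLE id` by `consistentTLE_toGen_of_realises`, `WF`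
  by §1, `K + 1 ≤ reach` by `lt_reach_of_pendingAt`, `SkelOK` by `skelOK_lin`), (v′) factorisation, (vi) remainder.
* §3 **`RLin.runReadingsFlowLE_typed`**: the binder `RunReadingsFlowLE` of the LE flow END
  (`SpaceTimeAssemblyLE.exists_irThresholdLE_relWeightBound`) inhabited from realised lineage data whose exponents are
  the run's own `expOf L R` frozen at `K`, the readings (i) (ii′) (iii′) (iv″) (v′) (vi), and TYPED FLOW FACTS ONLY
  ((2.7) at `p₀` and at `r`, (2.9), (2.5), the interval with monotone couplings, the located smallness of the drop
  control, `1 ≤ log g⁻²`, the infrared value).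
HONEST RESIDUE OF THE CONTOUR ROUTE after this file: (a) the identification of Bałaban's terms ∕ final live components
with realised histories on the COUNT carrier (`Realises`, `PendingAt` — H3-type, shared with the owner's route) and
`TypeNodup` (ruling R-A); (b) `LatSep` (print's merger criterion read contrapositively); (c) the factorisation (v′) and
remainder (vi) — A3a ∕ A3e ∕ A3f, NOT PRINTED as statements; (d) the typed flow facts (BetaPertH behind them); (e) (B)
inside `LowEnvelope` ×2.  `RenewAtReach` (F-1(c)) is GONE from this route.

HONEST DEPENDENCY (cell, verbatim): continuum YM on T⁴ ⇐ BetaPertH ∧ nine spine estimates (0/9 proved); BetaPertH ⇐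
(D1) ∧ (D4) ∧ CAP+tail; G-an2-4 gates asym, D1 and NE2/3/4.  This file changes none of it.
-/

open Finset

namespace Summit.QuantumFields.BalabanUV.T4Continuum.SpaceTimePeierls

open Literature.MathematicalPhysics.QuantumFieldTheory.Balaban1983to89
open Literature.MathematicalPhysics.QuantumFieldTheory.Balaban1983to89.B13ScaleTransfer
open Literature.MathematicalPhysics.QuantumFieldTheory.Balaban1983to89.B16SProfile
open T4PersistenceDictionary T4BankedInduction T4PrintedShapeBanking
open Summit.QuantumFields.BalabanUV.T4Continuum.ZoneTorus
open Summit.QuantumFields.BalabanUV.T4Continuum.HistoryZones (levelOf expOf expOf_succ_le dropCtl_expOf)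
open Summit.QuantumFields.BalabanUV.T4Continuum.HistoryAdmissible
open Summit.QuantumFields.BalabanUV.T4Continuum.HistoryRealise
open Summit.QuantumFields.BalabanUV.T4Continuum.HistoryBankingLE (ConsistentTLE)
open SpaceTimePeierlsLeaves

noncomputable section

open Classical

/-! ## §1 A realised history with distinct event types has a well-formed canonical label -/

section WF

variable {d L : ℕ} {s R : ℕ → ℕ} (hL : 4 ≤ L) (hdrop : ∀ m, DropCtl s m) (hR : ∀ t, 1 ≤ R t) {n₁ : ℕ}
  (hn₁ : 13 ≤ n₁)
include hL hdrop hR hn₁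

/-- **`Gen.WF` OF THE CANONICAL LABEL FROM THE GEOMETRY**: distinct event types give the distinctness clauses
(`distinct_toGen_iff`); a renewal happens after the root birth (`adm_of_realises`: `rootStep ≤ lastStep ≤ h`) and
strictly inside the booked life (`renew_lt_reach`); a join happens inside both partners' booked lives
(`lt_reach_of_pendingAt`) after their root births.  No `RenewAtReach`. [folklore] -/
theorem wf_toGen_of_realises :
    ∀ {P : PGen (Pt d × Finset (Pt d))} {Z : Finset (Pt d)}, P.TypeNodup → Realises L s R P Z →
      P.toGen.WF (dictW R n₁)
  | .birth _ _ _, _, _, _ => trivial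
  | .renew G h, Z, hT, hRZ => by
      have hD := (PGen.distinct_toGen_iff (PGen.renew G h)).2 hT
      simp only [PGen.toGen, PGen.DistinctEv] at hD
      have hT' : ((h + 1, 1, 0) : PEv) ∉ G.evTypes ∧ G.TypeNodup := by
        simpa [PGen.TypeNodup, PGen.evTypes, Multiset.nodup_cons] using hT
      have hlt : h < G.toGen.reach (dictW R n₁) := renew_lt_reach hL hdrop hR hn₁ hRZ
      obtain ⟨ZG, hG, hready, -, -⟩ := hRZ
      have hroot : G.rootStep ≤ G.lastStep := PGen.Adm.rootStep_le_lastStep (adm_of_realises G ZG hG le_rfl)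
      have hpos := hready.pos
      simp only [PGen.toGen, Gen.WF, PGen.rootStep_toGen]
      exact ⟨wf_toGen_of_realises hT'.2 hG, hD.2, by omega, hlt⟩
  | .join X Y sj, Z, hT, hRZ => by
      have hD := (PGen.distinct_toGen_iff (PGen.join X Y sj)).2 hT
      simp only [PGen.toGen, PGen.DistinctEv] at hD
      have hT' : (((sj, 2, 0) : PEv) ∉ X.evTypes ∧ ((sj, 2, 0) : PEv) ∉ Y.evTypes) ∧ X.TypeNodup ∧ Y.TypeNodup ∧
          Disjoint X.evTypes Y.evTypes := by
        simpa [PGen.TypeNodup, PGen.evTypes, Multiset.nodup_cons, Multiset.nodup_add] using hT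
      obtain ⟨-, hTX, hTY, -⟩ := hT'
      obtain ⟨ZX, ZY, hX, hY, htX, htY, hpX, hpY, -, -⟩ := hRZ
      have hrX : sj < X.toGen.reach (dictW R n₁) := lt_reach_of_pendingAt hL hdrop hR hn₁ hX hpX
      have hrY : sj < Y.toGen.reach (dictW R n₁) := lt_reach_of_pendingAt hL hdrop hR hn₁ hY hpY
      have hxr : X.rootStep ≤ X.lastStep := PGen.Adm.rootStep_le_lastStep (adm_of_realises X ZX hX le_rfl)
      have hyr : Y.rootStep ≤ Y.lastStep := PGen.Adm.rootStep_le_lastStep (adm_of_realises Y ZY hY le_rfl)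
      simp only [PGen.toGen, Gen.WF, PGen.rootStep_toGen]
      exact ⟨wf_toGen_of_realises hTX hX, wf_toGen_of_realises hTY hY, hD.2.2.1, hD.2.2.2.1, hD.2.2.2.2,
        by omega, by omega⟩

end WF

/-! ## §2 The LE lineage readings on the COUNT carrier -/

namespace RLin

variable {d n L Kx K : ℕ} {ℓ : ℕ → ℕ} {ι Λ : Type*} [DecidableEq Λ] (D : RLin d n L Kx K ℓ ι Λ)

/-- **THE LE LINEAGE READINGS ON THE COUNT CARRIER.**  As `RLin.lineageReadings` with the conclusion on the LE road
(`LineageReadingsLE`: admissibility `ConsistentTLE id`) and reading (iv″) = `Realises ∧ PendingAt K ∧ TypeNodup` per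
lineage — no `RenewAtReach`. [folklore] -/
theorem lineageReadingsLE {C : T4PrintedShapeBanking.Consts} {Kc : ℕ} {R : ℕ → ℕ} {g : ℕ → ℝ} {A : ι → ℝ}
    {Bad : Finset ι} {jlo : ℕ} {nup c₃ : ℝ} {rest : Finset (STCellV d n L Kx K ℓ) → ι → ℝ}
    -- the flow
    (hn : 0 < n) (hL : 4 ≤ L) (hmono : ∀ u, ℓ u ≤ ℓ (u + 1)) (hjump : ∀ u, ℓ (u + 1) ≤ ℓ u + 2)
    (hqℓ : ∀ u, ratio L D.s u = L ^ (ℓ (u + 1) - ℓ u)) (hdrop : ∀ m, DropCtl D.s m) (hR : ∀ t, 1 ≤ R t)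
    (hn₁ : 13 ≤ C.n₁) (hKc : K ≤ Kc)
    -- (i) nonnegative weights; the bad class
    (hnonneg : ∀ τ ∈ D.T, 0 ≤ A τ) (hBad : Bad ⊆ D.T) (hjlo : jlo ≤ K)
    -- (ii′) the old structure: a bad term has a lineage rooted at a step `≤ jlo`
    (hold : ∀ τ ∈ Bad, ∃ lam ∈ D.fam τ, (D.P lam).rootStep ≤ jlo)
    -- (iii′) lateral separation
    (hsep : D.LatSep)
    -- (iv″) realised, pending at the cutoff, distinct event types — nothing else
    (hreal : ∀ τ ∈ D.T, ∀ lam ∈ D.fam τ, Realises L D.s R (D.P lam) (D.Z lam) ∧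
      PendingAt L D.s R (D.P lam).lastStep (D.Z lam) K ∧ (D.P lam).TypeNodup)
    -- (v′) factorisation on the canonical label of the lineage containing the contour
    (hfac : ∀ (𝒦 : Finset (STCellV d n L Kx K ℓ)), ∀ τ ∈ D.T, D.toLinData.model.IsContour τ 𝒦 → ∀ lam ∈ D.fam τ,
      (∀ c ∈ 𝒦, D.toLinData.InLin lam c) →
        A τ ≤ Real.exp (-(credits (credit C g) (D.P lam).toGen -
          lifeCost (dictW R C.n₁) (cost C Kc R) (D.P lam).toGen)) * rest 𝒦 τ)
    -- (vi) the remainder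
    (hrest0 : ∀ (𝒦 : Finset (STCellV d n L Kx K ℓ)), ∀ τ ∈ D.T, 0 ≤ rest 𝒦 τ)
    (hrest : ∀ (𝒦 : Finset (STCellV d n L Kx K ℓ)),
      ∑ τ ∈ D.toLinData.model.T.filter (fun τ => D.toLinData.model.IsContour τ 𝒦), rest 𝒦 τ ≤
        Real.exp c₃ ^ 𝒦.card * nup) :
    LineageReadingsLE D.toLinData.model C K Kc R g A Bad jlo nup (3 ^ d + L ^ (2 * d) + 1)
      ((((3 ^ d + L ^ (2 * d) + 1 : ℕ) : ℝ) + 1) ^ 2) (((n * L ^ (Kx - ℓ K)) ^ d : ℕ) : ℝ)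
      (8 * 126 ^ d) (126 ^ d) ((127 : ℝ) ^ d + 3) c₃ := by
  -- (iv″) ⇒ the per-lineage facts, LE road
  have hlin : ∀ τ ∈ D.T, ∀ lam ∈ D.fam τ,
      ConsistentTLE id C Kc R (D.P lam).toGen ∧ (D.P lam).toGen.WF (dictW R C.n₁) ∧
      K + 1 ≤ (D.P lam).toGen.reach (dictW R C.n₁) ∧
      SkelOK D.toLinData.q D.toLinData.step D.toLinData.piece fatT ((127 : ℝ) ^ d + 3) (D.toLinData.G lam) := by
    intro τ hτ lam hlam
    obtain ⟨hRl, hPd, hT⟩ := hreal τ hτ lam hlam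
    have hlast : (D.P lam).lastStep ≤ K := hPd.1
    have hAK : (D.P lam).Adm Kc := adm_of_realises _ _ hRl (hlast.trans hKc)
    exact ⟨consistentTLE_toGen_of_realises hL hdrop hR C hn₁ _ _ hRl (hlast.trans hKc),
      wf_toGen_of_realises hL hdrop hR hn₁ hT hRl, lt_reach_of_pendingAt hL hdrop hR hn₁ hRl hPd,
      D.skelOK_lin hL hdrop hT hAK hRl⟩
  -- (iii′) ⇒ separation in the space-time cell graph
  have hsep' : D.toLinData.Separated :=
    D.toLinData.separated_of_lat (fat := fatT) (dC := (127 : ℝ) ^ d + 3) (by omega) hmono hqℓ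
      (fun τ hτ lam hlam => (hlin τ hτ lam hlam).2.2.2) (D.latSeparated hsep)
  -- the lineage containing a contour, with its cell bound on the canonical label
  have key : ∀ (τ : ι) (𝒦 : Finset (STCellV d n L Kx K ℓ)), τ ∈ D.T ∧ D.toLinData.model.IsContour τ 𝒦 →
      ∃ lam ∈ D.fam τ, (∀ c ∈ 𝒦, D.toLinData.InLin lam c) ∧
        (𝒦.card : ℝ) ≤ 8 * 126 ^ d * treeD PEv.fat PEv.step ((127 : ℝ) ^ d + 3) (D.P lam).toGen (K + 1) +
          126 ^ d * treeSteps PEv.step (D.P lam).toGen (K + 1) := by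
    intro τ 𝒦 h
    obtain ⟨lam, hlam, hin, hct⟩ := D.toLinData.card_contour_le_tree (fat := fatT) hsep' h.1 h.2 hL rfl (hdrop K)
      le_rfl (by positivity) fun lam hlam => (hlin τ h.1 lam hlam).2.2.2
    refine ⟨lam, hlam, hin, ?_⟩
    rw [D.treeD_eq, D.treeSteps_eq] at hct
    exact hct
  refine
    { deg := fun c => degree_stGraphV_le (by omega) hjump c
      animal := siteAnimalBound_sq (3 ^ d + L ^ (2 * d) + 1)
      anchors := ?_
      nonneg := hnonneg
      cover := D.toLinData.contourCover (fat := fatT) (dC := (127 : ℝ) ^ d + 3) hn (by omega) hmono hqℓ hBad hjlo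
        fun τ hτ => ?_
      lineage := ?_ }
  · have h := card_anchorsV_le (d := d) (n := n) (L := L) (Kx := Kx) (K := K) (ℓ := ℓ) (by omega) (D.hℓK K le_rfl)
    exact_mod_cast h
  · -- (ii′) ⇒ (ii): the root event of a lineage rooted before `jlo`
    obtain ⟨lam, hlam, hroot⟩ := hold τ hτ
    obtain ⟨hRl, -, -⟩ := hreal τ (hBad hτ) lam hlam
    obtain ⟨e, he, hst, hne⟩ := exists_root_event hRl
    refine ⟨lam, hlam, (hlin τ (hBad hτ) lam hlam).2.2.2, (lam, e), ?_, ?_, hne⟩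
    · rw [toLinData_G, ZoneSkeleton.events_gmap]
      exact mem_image_of_mem _ he
    · show PEv.step e ≤ jlo
      rw [hst]
      exact hroot
  · refine ⟨fun τ 𝒦 => if h : τ ∈ D.T ∧ D.toLinData.model.IsContour τ 𝒦 then
        (D.P (Classical.choose (key τ 𝒦 h))).toGen else Gen.born default 0, rest, fun _ _ => K + 1,
        fun 𝒦 τ hτ h𝒦 => ?_, hrest0, hrest⟩
    have hgen : (if h : τ ∈ D.T ∧ D.toLinData.model.IsContour τ 𝒦 then
        (D.P (Classical.choose (key τ 𝒦 h))).toGen else Gen.born default 0) =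
          (D.P (Classical.choose (key τ 𝒦 ⟨hτ, h𝒦⟩))).toGen := dif_pos ⟨hτ, h𝒦⟩
    beta_reduce
    rw [hgen]
    obtain ⟨hlam, hin, hcard⟩ := Classical.choose_spec (key τ 𝒦 ⟨hτ, h𝒦⟩)
    obtain ⟨hcons, hwf, hreach, -⟩ := hlin τ hτ _ hlam
    exact ⟨hcons, hwf, hreach, hcard, hfac 𝒦 τ hτ h𝒦 _ hlam hin⟩

end RLin

/-! ## §3 The binder of the LE flow end, inhabited from the carrier along the typed flow -/

namespace RLin

variable {d n L K : ℕ} {ι Λ : Type*} [DecidableEq Λ] {R : ℕ → ℕ}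
  (D : RLin d n L K K (levelOf (expOf L R) K) ι Λ)

/-- **`RunReadingsFlowLE` FROM THE REALISED DATA, THE READINGS (i) (ii′) (iii′) (iv″) (v′) (vi) AND TYPED FLOW FACTS
ONLY.**  Levels = the COUNT swarm's model scale of the run's own exponents `expOf L R`, torus exponent `K`, flow
exponents frozen at `K` (`D.s = extExp (expOf L R) K`); the two level facts come from the interval `0 < g ≤ γ ≤ 1`
with monotone couplings and from (2.7) at the size exponent `r` plus the located smallness of the drop control
(`SpaceTimeRealisedFlow`); reading (iv″) is `Realises ∧ PendingAt K ∧ TypeNodup`. [folklore] -/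
theorem runReadingsFlowLE_typed {C : T4PrintedShapeBanking.Consts} {r : ℕ} {γ β₀ x₀ β' : ℝ} {T : ℕ → Finset ι}
    {X : ℕ → ℝ → ι → ℝ} {Bad : ℕ → ℝ → Finset ι} {xup : ℕ → ℝ → ℝ} {jstar : ℕ → ℕ} {c₃ : ℝ} {t : ℝ}
    {Kc : ℕ} {g : ℕ → ℝ} {rest : Finset (STCellV d n L K K (levelOf (expOf L R) K)) → ι → ℝ}
    (hT : D.T = T K) (hDs : D.s = extExp (expOf L R) K)
    -- the typed flow facts of the run
    (hI : Step.InInterval γ Kc g) (hγ1 : γ ≤ 1) (hgmono : ∀ u, u < Kc → g u ≤ g (u + 1))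
    (h27 : B14.FlowIneq27 g β' β₀ C.p₀ Kc) (h27r : B14.FlowIneq27 g β' β₀ r Kc)
    (h29 : B14FlowStep.FlowIneq29 R g L β' β₀ Kc) (hRj : ∀ u, u ≤ Kc → B14.IsRj L r (g u) (R u))
    (hΘ : ∀ m u, m < u → u ≤ Kc → (1 + (g u) ^ 2 * β' * ((u : ℝ) - m)) ^ β₀ ≤ (L : ℝ) ^ (max (u - m) 2 / 2))
    (hx1 : ∀ u, u ≤ Kc → 1 ≤ Real.log ((g u) ^ 2)⁻¹) (hxK : x₀ ≤ Real.log ((g Kc) ^ 2)⁻¹)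
    -- the remaining hypotheses
    (hn : 0 < n) (hL : 4 ≤ L) (hR : ∀ t, 1 ≤ R t) (hn₁ : 13 ≤ C.n₁) (hKc : K ≤ Kc)
    (hnonneg : ∀ τ ∈ D.T, 0 ≤ X K t τ) (hBad : Bad K t ⊆ D.T) (hjlo : jstar K ≤ K)
    (hold : ∀ τ ∈ Bad K t, ∃ lam ∈ D.fam τ, (D.P lam).rootStep ≤ jstar K)
    (hsep : D.LatSep)
    (hreal : ∀ τ ∈ D.T, ∀ lam ∈ D.fam τ, Realises L D.s R (D.P lam) (D.Z lam) ∧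
      PendingAt L D.s R (D.P lam).lastStep (D.Z lam) K ∧ (D.P lam).TypeNodup)
    (hfac : ∀ (𝒦 : Finset (STCellV d n L K K (levelOf (expOf L R) K))), ∀ τ ∈ D.T,
      D.toLinData.model.IsContour τ 𝒦 → ∀ lam ∈ D.fam τ, (∀ c ∈ 𝒦, D.toLinData.InLin lam c) →
        X K t τ ≤ Real.exp (-(credits (credit C g) (D.P lam).toGen -
          lifeCost (dictW R C.n₁) (cost C Kc R) (D.P lam).toGen)) * rest 𝒦 τ)
    (hrest0 : ∀ (𝒦 : Finset (STCellV d n L K K (levelOf (expOf L R) K))), ∀ τ ∈ D.T, 0 ≤ rest 𝒦 τ)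
    (hrest : ∀ (𝒦 : Finset (STCellV d n L K K (levelOf (expOf L R) K))),
      ∑ τ ∈ D.toLinData.model.T.filter (fun τ => D.toLinData.model.IsContour τ 𝒦), rest 𝒦 τ ≤
        Real.exp c₃ ^ 𝒦.card * xup K t) :
    RunReadingsFlowLE C L r β₀ x₀ T X Bad xup jstar ((((3 ^ d + L ^ (2 * d) + 1 : ℕ) : ℝ) + 1) ^ 2)
      (((n * L ^ (K - levelOf (expOf L R) K K)) ^ d : ℕ) : ℝ) (8 * 126 ^ d) (126 ^ d) ((127 : ℝ) ^ d + 3)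
      c₃ K t := by
  have hL2 : 2 ≤ L := by omega
  -- the two level facts at the run's horizon `Kc`, restricted to `K`
  have hsKc : ∀ u, u < Kc → expOf L R (u + 1) ≤ expOf L R u :=
    expOf_succ_le hL2 hRj (fun u hu => (hI u hu).1) (fun u hu => (hI u hu).2.trans hγ1) hgmono
  have hdropKc : DropCtl (expOf L R) Kc := dropCtl_expOf hL2 hI hγ1 hRj h27r hΘ
  have hs : ∀ u, u < K → expOf L R (u + 1) ≤ expOf L R u := fun u hu => hsKc u (lt_of_lt_of_le hu hKc)
  have hdropK : DropCtl (expOf L R) K := fun i k hik hk => hdropKc i k hik (hk.trans hKc)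
  exact ⟨STCellV d n L K K (levelOf (expOf L R) K), inferInstance, inferInstance, D.toLinData.model, inferInstance,
    3 ^ d + L ^ (2 * d) + 1, Kc, R, g, β', hT, h27, h29, hRj, hx1, hxK,
    D.lineageReadingsLE hn hL (levelOf_mono' hs hdropK) (levelOf_jump hs hdropK)
      (fun u => by rw [hDs]; exact ratio_extExp_eq hs hdropK L u)
      (fun m => by rw [hDs]; exact dropCtl_extExp hdropK m)
      hR hn₁ hKc hnonneg hBad hjlo hold hsep hreal hfac hrest0 hrest⟩

end RLin

end

end Summit.QuantumFields.BalabanUV.T4Continuum.SpaceTimePeierls
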